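import Summits.MatrixMultiplication.MatrixMultiplication.Theses.ToricBorderRank

/-!
# `HilbertMumfordHalf`, direction (⇐): an `SL³`-translate that is a toric parent degenerates to `⟨n,n,n⟩`

Route `ToricBorderRank` of `MatrixMultiplication`, support item `HilbertMumfordHalf`
(stmt-MatrixMultiplication-9968):
`⟨n,n,n⟩ ∈ cl(SL³·T)` iff some `SL³`-translate `g·T` of `T` is a *toric parent* of `⟨n,n,n⟩`, i.e.
there are integer weights `α, β, γ` on the three index sets `Fin n × Fin n` with
(W0) `α a + β b + γ c = 0` on the support of `⟨n,n,n⟩ = matMulTensor ℂ n n n` and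
(W1) `g·T = ⟨n,n,n⟩` on every cell of weight `≤ 0`.

This file proves the implication (⇐) for every `n` and `T` (`hilbertMumfordHalf_mpr`), with no
hypothesis beyond the item's own.

## Proof

Let `N = n²` and `sα = ∑ α`, `sβ = ∑ β`, `sγ = ∑ γ`. Summing (W0) over the `n³` support cells
`((κ,ν),(κ,μ),(μ,ν))` of `⟨n,n,n⟩` gives `n · (sα + sβ + sγ) = 0` (`weightSum_eq_zero_of_W0`): the
total weight vanishes — the elementary shadow of "`det ∘ flattening` is an `SL³`-invariant not
vanishing at `⟨n,n,n⟩`". Put `e₁ = sα - N·α`, `e₂ = sβ - N·β`, `e₃ = sγ - N·γ` (each of total sum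
`0`) and, for real `s`, `D(s) = (diag e^{s e₁}, diag e^{s e₂}, diag e^{s e₃}) ∈ SL³`. Then
`(D(s)·g·T)_{abc} = e^{-s N (α a + β b + γ c)} (g·T)_{abc}`, which tends, as `s → +∞`, to `0` on cells
of positive weight (where `⟨n,n,n⟩` vanishes by (W0)), and is constantly `(g·T)_{abc} = ⟨n,n,n⟩_{abc}`
on cells of weight `≤ 0` by (W1) (on negative cells both sides are `0` by (W0)). Hence
`D(s)·g·T → ⟨n,n,n⟩` inside the orbit `SL³·T`.
-/

set_option linter.dupNamespace false

namespace Summit.MatrixMultiplication.MatrixMultiplication.Theorems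

open scoped BigOperators
open Filter Topology
open Literature.Computability.AlgebraicComplexity

/-- Diagonal rescalings pull out of the factorwise triple action:
`((diag d₁ · A) ⊗ (diag d₂ · B) ⊗ (diag d₃ · C))·T = d₁(a) d₂(b) d₃(c) · ((A ⊗ B ⊗ C)·T)` entrywise. -/
theorem tripleSum_diagonal_mul {τ : Type*} [Fintype τ] [DecidableEq τ] (d₁ d₂ d₃ : τ → ℂ)
    (A B C : Matrix τ τ ℂ) (T : τ → τ → τ → ℂ) (a b c : τ) :
    ∑ a', ∑ b', ∑ c', (Matrix.diagonal d₁ * A) a a' * (Matrix.diagonal d₂ * B) b b' *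
        (Matrix.diagonal d₃ * C) c c' * T a' b' c' =
      d₁ a * d₂ b * d₃ c * ∑ a', ∑ b', ∑ c', A a a' * B b b' * C c c' * T a' b' c' := by
  simp only [Matrix.diagonal_mul, Finset.mul_sum]
  refine Finset.sum_congr rfl fun a' _ => Finset.sum_congr rfl fun b' _ =>
    Finset.sum_congr rfl fun c' _ => ?_
  ring

/-- (W0) forces the total weight to vanish: if `α a + β b + γ c = 0` on the support of `⟨n,n,n⟩`
(`n ≥ 1`), then `∑ α + ∑ β + ∑ γ = 0` — sum (W0) over the `n³` support cells
`((κ,ν),(κ,μ),(μ,ν))`, each index occurring in exactly `n` of them. -/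
theorem weightSum_eq_zero_of_W0 {n : ℕ} (hn : 0 < n) (α β γ : Fin n × Fin n → ℤ)
    (h0 : ∀ a b c, matMulTensor ℂ n n n a b c ≠ 0 → α a + β b + γ c = 0) :
    ∑ a, α a + ∑ b, β b + ∑ c, γ c = 0 := by
  have key : ∀ κ μ ν : Fin n, α (κ, ν) + β (κ, μ) + γ (μ, ν) = 0 := fun κ μ ν =>
    h0 (κ, ν) (κ, μ) (μ, ν) (by simp [matMulTensor])
  have hsum : ∑ κ : Fin n, ∑ μ : Fin n, ∑ ν : Fin n, (α (κ, ν) + β (κ, μ) + γ (μ, ν)) = 0 :=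
    Finset.sum_eq_zero fun κ _ => Finset.sum_eq_zero fun μ _ =>
      Finset.sum_eq_zero fun ν _ => key κ μ ν
  have hα : ∑ κ : Fin n, ∑ μ : Fin n, ∑ ν : Fin n, α (κ, ν) = n * ∑ a, α a := by
    rw [Fintype.sum_prod_type, Finset.mul_sum]
    refine Finset.sum_congr rfl fun κ _ => ?_
    rw [Finset.sum_const, Finset.card_univ, Fintype.card_fin, nsmul_eq_mul]
  have hβ : ∑ κ : Fin n, ∑ μ : Fin n, ∑ ν : Fin n, β (κ, μ) = n * ∑ b, β b := by
    rw [Fintype.sum_prod_type, Finset.mul_sum]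
    refine Finset.sum_congr rfl fun κ _ => ?_
    rw [Finset.mul_sum]
    refine Finset.sum_congr rfl fun μ _ => ?_
    rw [Finset.sum_const, Finset.card_univ, Fintype.card_fin, nsmul_eq_mul]
  have hγ : ∑ κ : Fin n, ∑ μ : Fin n, ∑ ν : Fin n, γ (μ, ν) = n * ∑ c, γ c := by
    rw [Finset.sum_const, Finset.card_univ, Fintype.card_fin, nsmul_eq_mul, Fintype.sum_prod_type]
  have hsplit : ∑ κ : Fin n, ∑ μ : Fin n, ∑ ν : Fin n, (α (κ, ν) + β (κ, μ) + γ (μ, ν)) =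
      n * (∑ a, α a + ∑ b, β b + ∑ c, γ c) := by
    simp only [Finset.sum_add_distrib]
    rw [hα, hβ, hγ]
    ring
  rw [hsplit] at hsum
  have hn' : (n : ℤ) ≠ 0 := by exact_mod_cast hn.ne'
  exact (mul_eq_zero.mp hsum).resolve_left hn'

/-- The determinant of `diag (e^{s e(a)})` is `1` when `∑ e = 0`. -/
theorem det_diagonal_exp_intWeight {τ : Type*} [Fintype τ] [DecidableEq τ] (e : τ → ℤ)
    (he : ∑ a, e a = 0) (s : ℝ) :
    (Matrix.diagonal fun a => ((Real.exp (s * (e a : ℝ)) : ℝ) : ℂ)).det = 1 := by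
  rw [Matrix.det_diagonal, ← Complex.ofReal_prod, ← Real.exp_sum, ← Finset.mul_sum]
  have : ∑ a, (e a : ℝ) = 0 := by exact_mod_cast he
  rw [this, mul_zero, Real.exp_zero, Complex.ofReal_one]

/-- **`HilbertMumfordHalf`, direction (⇐).** If some `SL³`-translate `g·T` of `T` is a toric parent
of `⟨n,n,n⟩` (integer diagonal weights with (W0) on the support and (W1) on the closed negative
half-space), then `⟨n,n,n⟩` lies in the Euclidean closure of the `SL³`-orbit of `T`: the diagonal
one-parameter family `D(s) = (diag e^{s(∑α - n²α)}, diag e^{s(∑β - n²β)}, diag e^{s(∑γ - n²γ)})` lies in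
`SL³` because (W0) forces `∑α + ∑β + ∑γ = 0`, and `D(s)·g·T → ⟨n,n,n⟩` as `s → +∞`. -/
theorem hilbertMumfordHalf_mpr (n : ℕ)
    (T : Fin n × Fin n → Fin n × Fin n → Fin n × Fin n → ℂ)
    (h : ∃ (g : Matrix.SpecialLinearGroup (Fin n × Fin n) ℂ ×
        Matrix.SpecialLinearGroup (Fin n × Fin n) ℂ × Matrix.SpecialLinearGroup (Fin n × Fin n) ℂ)
        (α β γ : Fin n × Fin n → ℤ),
        (∀ a b c, Literature.Computability.AlgebraicComplexity.matMulTensor ℂ n n n a b c ≠ 0 →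
          α a + β b + γ c = 0) ∧
        (∀ a b c, α a + β b + γ c ≤ 0 → ∑ a', ∑ b', ∑ c',
          (g.1 : Matrix (Fin n × Fin n) (Fin n × Fin n) ℂ) a a' *
          (g.2.1 : Matrix (Fin n × Fin n) (Fin n × Fin n) ℂ) b b' *
          (g.2.2 : Matrix (Fin n × Fin n) (Fin n × Fin n) ℂ) c c' * T a' b' c' =
            Literature.Computability.AlgebraicComplexity.matMulTensor ℂ n n n a b c)) :
    Literature.Computability.AlgebraicComplexity.matMulTensor ℂ n n n ∈ closure (Set.range
      fun g : Matrix.SpecialLinearGroup (Fin n × Fin n) ℂ ×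
          Matrix.SpecialLinearGroup (Fin n × Fin n) ℂ × Matrix.SpecialLinearGroup (Fin n × Fin n) ℂ =>
        (fun a b c => ∑ a', ∑ b', ∑ c', (g.1 : Matrix (Fin n × Fin n) (Fin n × Fin n) ℂ) a a' *
          (g.2.1 : Matrix (Fin n × Fin n) (Fin n × Fin n) ℂ) b b' *
          (g.2.2 : Matrix (Fin n × Fin n) (Fin n × Fin n) ℂ) c c' * T a' b' c')) := by
  rcases Nat.eq_zero_or_pos n with rfl | hn
  · exact subset_closure ⟨1, Subsingleton.elim _ _⟩
  obtain ⟨g, α, β, γ, h0, h1⟩ := h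
  -- notation
  set M := Literature.Computability.AlgebraicComplexity.matMulTensor ℂ n n n with hM
  set gT : Fin n × Fin n → Fin n × Fin n → Fin n × Fin n → ℂ := fun a b c => ∑ a', ∑ b', ∑ c',
      (g.1 : Matrix (Fin n × Fin n) (Fin n × Fin n) ℂ) a a' *
      (g.2.1 : Matrix (Fin n × Fin n) (Fin n × Fin n) ℂ) b b' *
      (g.2.2 : Matrix (Fin n × Fin n) (Fin n × Fin n) ℂ) c c' * T a' b' c' with hgT
  have h1' : ∀ a b c, α a + β b + γ c ≤ 0 → gT a b c = M a b c := h1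
  -- the total weight vanishes
  set N : ℤ := (Fintype.card (Fin n × Fin n) : ℤ) with hN
  haveI : Nonempty (Fin n × Fin n) := ⟨(⟨0, hn⟩, ⟨0, hn⟩)⟩
  have hNpos : 0 < N := by
    rw [hN]; exact_mod_cast Fintype.card_pos
  have hs : ∑ a, α a + ∑ b, β b + ∑ c, γ c = 0 := weightSum_eq_zero_of_W0 hn α β γ h0
  -- integer exponents of total sum zero
  set e₁ : Fin n × Fin n → ℤ := fun a => ∑ x, α x - N * α a with he₁
  set e₂ : Fin n × Fin n → ℤ := fun b => ∑ x, β x - N * β b with he₂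
  set e₃ : Fin n × Fin n → ℤ := fun c => ∑ x, γ x - N * γ c with he₃
  have hsum₁ : ∑ a, e₁ a = 0 := by
    simp only [he₁, Finset.sum_sub_distrib, Finset.sum_const, Finset.card_univ, ← Finset.mul_sum,
      nsmul_eq_mul, hN]
    ring
  have hsum₂ : ∑ b, e₂ b = 0 := by
    simp only [he₂, Finset.sum_sub_distrib, Finset.sum_const, Finset.card_univ, ← Finset.mul_sum,
      nsmul_eq_mul, hN]
    ring
  have hsum₃ : ∑ c, e₃ c = 0 := by
    simp only [he₃, Finset.sum_sub_distrib, Finset.sum_const, Finset.card_univ, ← Finset.mul_sum,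
      nsmul_eq_mul, hN]
    ring
  have hwt : ∀ a b c, e₁ a + e₂ b + e₃ c = -(N * (α a + β b + γ c)) := by
    intro a b c
    simp only [he₁, he₂, he₃]
    linear_combination hs
  -- the diagonal one-parameter family inside SL³
  let D : ℝ → Matrix.SpecialLinearGroup (Fin n × Fin n) ℂ ×
      Matrix.SpecialLinearGroup (Fin n × Fin n) ℂ × Matrix.SpecialLinearGroup (Fin n × Fin n) ℂ :=
    fun s => (⟨Matrix.diagonal fun a => ((Real.exp (s * (e₁ a : ℝ)) : ℝ) : ℂ),
        det_diagonal_exp_intWeight e₁ hsum₁ s⟩,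
      ⟨Matrix.diagonal fun b => ((Real.exp (s * (e₂ b : ℝ)) : ℝ) : ℂ),
        det_diagonal_exp_intWeight e₂ hsum₂ s⟩,
      ⟨Matrix.diagonal fun c => ((Real.exp (s * (e₃ c : ℝ)) : ℝ) : ℂ),
        det_diagonal_exp_intWeight e₃ hsum₃ s⟩)
  let F : ℝ → Fin n × Fin n → Fin n × Fin n → Fin n × Fin n → ℂ := fun s =>
    (fun g' : Matrix.SpecialLinearGroup (Fin n × Fin n) ℂ ×
          Matrix.SpecialLinearGroup (Fin n × Fin n) ℂ × Matrix.SpecialLinearGroup (Fin n × Fin n) ℂ =>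
        (fun a b c => ∑ a', ∑ b', ∑ c', (g'.1 : Matrix (Fin n × Fin n) (Fin n × Fin n) ℂ) a a' *
          (g'.2.1 : Matrix (Fin n × Fin n) (Fin n × Fin n) ℂ) b b' *
          (g'.2.2 : Matrix (Fin n × Fin n) (Fin n × Fin n) ℂ) c c' * T a' b' c')) (D s * g)
  have hmem : ∀ s, F s ∈ Set.range
      fun g : Matrix.SpecialLinearGroup (Fin n × Fin n) ℂ ×
          Matrix.SpecialLinearGroup (Fin n × Fin n) ℂ × Matrix.SpecialLinearGroup (Fin n × Fin n) ℂ =>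
        (fun a b c => ∑ a', ∑ b', ∑ c', (g.1 : Matrix (Fin n × Fin n) (Fin n × Fin n) ℂ) a a' *
          (g.2.1 : Matrix (Fin n × Fin n) (Fin n × Fin n) ℂ) b b' *
          (g.2.2 : Matrix (Fin n × Fin n) (Fin n × Fin n) ℂ) c c' * T a' b' c') :=
    fun s => ⟨D s * g, rfl⟩
  -- closed form of the family
  have hF : ∀ s a b c, F s a b c =
      ((Real.exp (s * ((e₁ a + e₂ b + e₃ c : ℤ) : ℝ)) : ℝ) : ℂ) * gT a b c := by
    intro s a b c
    show ∑ a', ∑ b', ∑ c', (((D s).1 * g.1 : Matrix.SpecialLinearGroup (Fin n × Fin n) ℂ) :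
        Matrix (Fin n × Fin n) (Fin n × Fin n) ℂ) a a' *
        (((D s).2.1 * g.2.1 : Matrix.SpecialLinearGroup (Fin n × Fin n) ℂ) :
          Matrix (Fin n × Fin n) (Fin n × Fin n) ℂ) b b' *
        (((D s).2.2 * g.2.2 : Matrix.SpecialLinearGroup (Fin n × Fin n) ℂ) :
          Matrix (Fin n × Fin n) (Fin n × Fin n) ℂ) c c' * T a' b' c' = _
    rw [Matrix.SpecialLinearGroup.coe_mul, Matrix.SpecialLinearGroup.coe_mul,
      Matrix.SpecialLinearGroup.coe_mul]
    rw [tripleSum_diagonal_mul]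
    congr 1
    rw [← Complex.ofReal_mul, ← Complex.ofReal_mul, ← Real.exp_add, ← Real.exp_add]
    push_cast
    ring_nf
  -- the limit
  have hlim : Tendsto F atTop (𝓝 M) := by
    refine tendsto_pi_nhds.2 fun a => tendsto_pi_nhds.2 fun b => tendsto_pi_nhds.2 fun c => ?_
    simp only [hF]
    rcases lt_trichotomy (α a + β b + γ c) 0 with hw | hw | hw
    · -- negative weight: both sides vanish
      have hMz : M a b c = 0 := by
        by_contra hne
        exact absurd (h0 a b c hne) hw.ne
      have hgz : gT a b c = 0 := (h1' a b c hw.le).trans hMz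
      simp only [hgz, hMz, mul_zero]
      exact tendsto_const_nhds
    · -- weight zero: the family is constant there
      have heq : gT a b c = M a b c := h1' a b c hw.le
      have he0 : e₁ a + e₂ b + e₃ c = 0 := by rw [hwt, hw, mul_zero, neg_zero]
      simp only [he0, Int.cast_zero, mul_zero, Real.exp_zero, Complex.ofReal_one, one_mul, heq]
      exact tendsto_const_nhds
    · -- positive weight: exponential decay to `0 = M a b c`
      have hMz : M a b c = 0 := by
        by_contra hne
        exact absurd (h0 a b c hne) hw.ne'
      rw [hMz]
      have hneg : ((e₁ a + e₂ b + e₃ c : ℤ) : ℝ) < 0 := by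
        have : e₁ a + e₂ b + e₃ c < 0 := by
          rw [hwt]; exact neg_neg_of_pos (mul_pos hNpos hw)
        exact_mod_cast this
      have hexp : Tendsto (fun s : ℝ => Real.exp (s * ((e₁ a + e₂ b + e₃ c : ℤ) : ℝ))) atTop
          (𝓝 0) :=
        Real.tendsto_exp_atBot.comp (tendsto_id.atTop_mul_const_of_neg hneg)
      have hexpC : Tendsto (fun s : ℝ => ((Real.exp (s * ((e₁ a + e₂ b + e₃ c : ℤ) : ℝ)) : ℝ) : ℂ))
          atTop (𝓝 0) := by
        have h := (Complex.continuous_ofReal.tendsto 0).comp hexp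
        rwa [Complex.ofReal_zero] at h
      have h := hexpC.mul_const (gT a b c)
      rwa [zero_mul] at h
  exact mem_closure_of_tendsto hlim (Eventually.of_forall hmem)

end Summit.MatrixMultiplication.MatrixMultiplication.Theorems
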